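import Mathlib
import Literature.Computability.AlgebraicComplexity.StandardFamilies
import Summits.ValiantsHypothesis.ValiantsHypothesis.Theorems.ValuativeGCTValuativeFlipPencilEvalCertificate
import Summits.ValiantsHypothesis.ValiantsHypothesis.Theorems.ValuativeGCTValuativeFlipPencilRankCertificates

/-!
# Evaluation certificates for the four-row pencil rank, II: the trusted check and its soundness

Helper file (`--supports stmt-ValiantsHypothesis-12624`) for crux `ValuativeGCT.ValuativeFlip`, line
`four-row-count`, wall-breaker axis k14 "small cases certified"; continues
`Theorems/ValuativeGCTValuativeFlipPencilEvalCertificate.lean` (certificate data, the member values as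
integers / modulo `certP`, the value table `valTable` and its spec `valTable_get`).

* `solveCert` — UNTRUSTED Gaussian elimination modulo `certP` (its output is only ever checked): from
  the value table it selects `r` members and `r` points and proposes an inverse of the `r × r` matrix
  of values;
* `mulCheckN` / `mulCheckN_sound` — a fast array-based check of `E · N = 1 (mod certP)` on `ℕ`, sound
  for the matrices cast to `ZMod certP`;
* `pencilCheck n P r : Bool` — the whole pipeline (value table once, solver, check), and
  **`le_finrank_of_pencilCheck`**: `pencilCheck n P r = true →
  r ≤ finrank ℂ (span ℂ (range fun (t,(k,l)) => X t * (∂_{kl} per_{n+1})(M·X)))` for the integer pencil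
  `M = pencilZ n` cast to `ℂ` — exactly the `m`-free family of `frt_finrank_fourRowSpan_ge`
  (`Theorems/ValuativeGCTValuativeFlipFourRowTransfer.lean`).  Chain: check ⇒ `E · N = 1` over
  `ZMod certP` for `E` = values of the selected members at the selected points (`valTable_get`) ⇒
  `det E ≠ 0 (mod certP)` ⇒ `det ≠ 0` over `ℂ` for the INTEGER matrix of values
  (`valP_eq_cast`, `prc_det_intCast_ne_zero_of_det_zmod_ne_zero`) whose entries are the evaluation
  functionals on the members (`aeval_member_eq_cast`) ⇒ the selected members are linearly independent
  (`prc_linearIndependent_of_det_ne_zero`) ⇒ `r ≤ finrank` (`prc_card_le_finrank_span_of_linearIndependent_comp`).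

The instances (`pencilCheck 8 240 220 = true` etc. by `native_decide`) and the resulting four-row flips /
multiplicity obstructions above the bottom of the window live in the follow-up instances files
(computational lane). [folklore; this crux's …PencilRankCertificates.lean (certificate formats)]
-/

set_option linter.dupNamespace false

namespace Summit.ValiantsHypothesis.ValiantsHypothesis.Theorems.ValuativeFlip

open MvPolynomial
open scoped BigOperators Matrix
open Literature.Computability.AlgebraicComplexity

/-! ## The untrusted solver (plain Gaussian elimination modulo `certP`; never trusted) -/

/-- `a^e mod m` by binary powering (64 rounds). [folklore] -/
def powMod (a e m : ℕ) : ℕ := Id.run do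
  let mut result := 1 % m
  let mut base := a % m
  let mut ex := e
  for _ in [0:64] do
    if ex % 2 = 1 then
      result := result * base % m
    base := base * base % m
    ex := ex / 2
  return result

/-- Inverse modulo the prime `certP` (Fermat). [folklore] -/
def invModP (a : ℕ) : ℕ := powMod a (certP - 2) certP

/-- Gauss–Jordan inverse of an `r × r` matrix modulo `certP` (untrusted; garbage if singular).
[folklore] -/
def gaussJordanInv (E : Array (Array ℕ)) (r : ℕ) : Array (Array ℕ) := Id.run do
  let p := certP
  let mut M : Array (Array ℕ) := Array.ofFn fun a : Fin r =>
    Array.ofFn fun c : Fin (2 * r) =>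
      if (c : ℕ) < r then ((E.getD a #[]).getD c 0) % p else (if (c : ℕ) = r + a then 1 else 0)
  for c in [0:r] do
    let mut piv := r
    for i in [0:r] do
      if piv = r ∧ c ≤ i ∧ (M.getD i #[]).getD c 0 ≠ 0 then
        piv := i
    if piv < r then
      let rowP := M.getD piv #[]
      let rowC := M.getD c #[]
      M := (M.setIfInBounds piv rowC).setIfInBounds c rowP
      let f := invModP (rowP.getD c 0)
      let rowN : Array ℕ := Array.ofFn fun q : Fin (2 * r) => rowP.getD q 0 * f % p
      M := M.setIfInBounds c rowN
      for i in [0:r] do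
        if i ≠ c then
          let rowI := M.getD i #[]
          let g := rowI.getD c 0
          if g ≠ 0 then
            let rowI' : Array ℕ := Array.ofFn fun q : Fin (2 * r) =>
              (rowI.getD q 0 + p * p - g * rowN.getD q 0) % p
            M := M.setIfInBounds i rowI'
  return Array.ofFn fun a : Fin r => Array.ofFn fun c : Fin r => (M.getD a #[]).getD (r + c) 0

/-- The untrusted solver: from the value table (`P` points × `K` members, values modulo `certP`)
select `r` independent members (processed in order, reduced against the pivots found so far), their
pivot points, and propose the inverse of the `r × r` matrix `E a b = value (point a) (member b)`.
Returns `(members, points, inverse)`. [folklore] -/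
def solveCert (tbl : Array (Array ℕ)) (K P r : ℕ) : Array ℕ × Array ℕ × Array (Array ℕ) := Id.run do
  let p := certP
  let mut pivRows : Array (Array ℕ) := #[]
  let mut pivCols : Array ℕ := #[]
  let mut members : Array ℕ := #[]
  for μ in [0:K] do
    if members.size < r then
      let mut row : Array ℕ := Array.ofFn fun b : Fin P => (tbl.getD b #[]).getD μ 0
      for i in [0:pivRows.size] do
        let c := pivCols.getD i 0
        let f := row.getD c 0
        if f ≠ 0 then
          let pr := pivRows.getD i #[]
          row := Array.ofFn fun b : Fin P => (row.getD b 0 + p * p - f * pr.getD b 0) % p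
      match (List.range P).find? (fun b => row.getD b 0 ≠ 0) with
      | none => pure ()
      | some c =>
        let f := invModP (row.getD c 0)
        let rowN : Array ℕ := Array.ofFn fun b : Fin P => row.getD b 0 * f % p
        pivRows := pivRows.push rowN
        pivCols := pivCols.push c
        members := members.push μ
  let E : Array (Array ℕ) := Array.ofFn fun a : Fin r => Array.ofFn fun b : Fin r =>
    (tbl.getD (pivCols.getD a 0) #[]).getD (members.getD b 0) 0
  return (members, pivCols, gaussJordanInv E r)

/-! ## A fast check of `E · N = 1 (mod certP)` on natural-number matrices -/

/-- `Σ_{j < m} rowE[j] · colN[j]` on arrays. [folklore] -/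
def dotN (rowE colN : Array ℕ) : ℕ → ℕ
  | 0 => 0
  | m + 1 => dotN rowE colN m + rowE.getD m 0 * colN.getD m 0

/-- `dotN` is the sum. [folklore] -/
theorem dotN_eq (rowE colN : Array ℕ) :
    ∀ m : ℕ, dotN rowE colN m = ∑ j : Fin m, rowE.getD j 0 * colN.getD j 0
  | 0 => by simp [dotN]
  | m + 1 => by
      rw [dotN, Fin.sum_univ_castSucc, dotN_eq rowE colN m]
      simp only [Fin.val_castSucc, Fin.val_last]

/-- The check `E · N ≡ 1 (mod certP)`, rows of `E` and columns of `N` materialised once. [folklore] -/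
def mulCheckN (r : ℕ) (E N : Matrix (Fin r) (Fin r) ℕ) : Bool :=
  let EA : Array (Array ℕ) := Array.ofFn fun i : Fin r => Array.ofFn fun j : Fin r => E i j
  let NA : Array (Array ℕ) := Array.ofFn fun k : Fin r => Array.ofFn fun j : Fin r => N j k
  (List.finRange r).all fun i => (List.finRange r).all fun k =>
    (dotN (EA.getD i #[]) (NA.getD k #[]) r % certP == (if i = k then 1 else 0))

/-- In range, `(Array.ofFn f).getD` is `f`. [folklore] -/
theorem getD_ofFn {α : Type*} {m : ℕ} (f : Fin m → α) (d : α) (j : Fin m) :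
    (Array.ofFn f).getD j d = f j := by
  rw [array_getD_of_lt _ _ _ (by rw [Array.size_ofFn]; exact j.2), Array.getElem_ofFn]

/-- Reading a materialised `r × r` family of arrays. [folklore] -/
theorem getD_ofFn_ofFn {r : ℕ} (F : Fin r → Fin r → ℕ) (i j : Fin r) :
    ((Array.ofFn fun i : Fin r => Array.ofFn fun j : Fin r => F i j).getD i #[]).getD j 0 = F i j := by
  rw [getD_ofFn (fun i : Fin r => Array.ofFn fun j : Fin r => F i j) #[] i, getD_ofFn]

/-- **Soundness of the fast product check**: `mulCheckN r E N = true` gives `E · N = 1` over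
`ZMod certP` for the cast matrices. [folklore] -/
theorem mulCheckN_sound (r : ℕ) (E N : Matrix (Fin r) (Fin r) ℕ) (h : mulCheckN r E N = true) :
    E.map (Nat.cast : ℕ → ZMod certP) * N.map (Nat.cast : ℕ → ZMod certP) = 1 := by
  ext i k
  rw [Matrix.mul_apply, Matrix.one_apply]
  simp only [mulCheckN, List.all_eq_true, List.mem_finRange, true_implies, beq_iff_eq] at h
  have hik := h i k
  rw [dotN_eq] at hik
  simp only [getD_ofFn_ofFn] at hik
  have hc := congrArg (Nat.cast : ℕ → ZMod certP) hik
  rw [ZMod.natCast_mod, Nat.cast_sum] at hc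
  simp only [Nat.cast_mul, Nat.cast_ite, Nat.cast_one, Nat.cast_zero] at hc
  simpa only [Matrix.map_apply] using hc

/-! ## The trusted check and its soundness -/

/-- Selected member `b` (clamped into range; any value is sound). [folklore] -/
def selMember (n : ℕ) (sol : Array ℕ × Array ℕ × Array (Array ℕ)) (b : ℕ) :
    Fin 4 × (Fin (n + 1) × Fin (n + 1)) :=
  (memberEquiv n).symm ⟨sol.1.getD b 0 % (4 * ((n + 1) * (n + 1))),
    Nat.mod_lt _ (by positivity)⟩

/-- Selected point `a` (clamped below `P`; any value is sound). [folklore] -/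
def selPoint (P : ℕ) [NeZero P] (sol : Array ℕ × Array ℕ × Array (Array ℕ)) (a : ℕ) : ℕ :=
  sol.2.1.getD a 0 % P

/-- `selPoint < P`. [folklore] -/
theorem selPoint_lt (P : ℕ) [NeZero P] (sol : Array ℕ × Array ℕ × Array (Array ℕ)) (a : ℕ) :
    selPoint P sol a < P :=
  Nat.mod_lt _ (Nat.pos_of_ne_zero (NeZero.ne P))

/-- SPEC of the certificate matrix: `E a b` = modular value of the selected member `b` at the selected
point `a`. [folklore] -/
def Espec (n P r : ℕ) [NeZero P] (sol : Array ℕ × Array ℕ × Array (Array ℕ)) :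
    Matrix (Fin r) (Fin r) (ZMod certP) :=
  Matrix.of fun a b => valP n (fun t => pointZ (selPoint P sol a) t) (selMember n sol b)

/-- FAST certificate matrix on `ℕ`: a trivial accessor reading a value table `tbl` (meant to be
`valTable n P`, passed in evaluated). [folklore] -/
def EfastN (n P r : ℕ) [NeZero P] (tbl : Array (Array ℕ)) (sol : Array ℕ × Array ℕ × Array (Array ℕ)) :
    Matrix (Fin r) (Fin r) ℕ :=
  Matrix.of fun a b =>
    (tbl.getD (selPoint P sol a) #[]).getD ((memberEquiv n (selMember n sol b) : Fin _) : ℕ) 0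

/-- `EfastN (valTable n P)` casts to `Espec` entrywise (`valTable_get`). [folklore] -/
theorem natCast_EfastN_apply (n P r : ℕ) [NeZero P] (sol : Array ℕ × Array ℕ × Array (Array ℕ))
    (a b : Fin r) :
    ((EfastN n P r (valTable n P) sol a b : ℕ) : ZMod certP) =
      valP n (fun t => pointZ (selPoint P sol a) t) (selMember n sol b) := by
  have h1 : selPoint P sol a < (valTable n P).size := by
    rw [size_valTable]; exact selPoint_lt P sol a
  have h2 : ((memberEquiv n (selMember n sol b) : Fin _) : ℕ) <
      ((valTable n P)[selPoint P sol a]).size := by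
    rw [size_valTable_get]; exact (memberEquiv n (selMember n sol b)).2
  have h3 : EfastN n P r (valTable n P) sol a b =
      ((valTable n P)[selPoint P sol a])[((memberEquiv n (selMember n sol b) : Fin _) : ℕ)] := by
    unfold EfastN
    rw [Matrix.of_apply, array_getD_of_lt _ _ _ h1, array_getD_of_lt _ _ _ h2]
  rw [h3, valTable_get]
  simp only [Fin.eta, Equiv.symm_apply_apply]

/-- `EfastN (valTable n P)` casts to `Espec`. [folklore] -/
theorem map_EfastN (n P r : ℕ) [NeZero P] (sol : Array ℕ × Array ℕ × Array (Array ℕ)) :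
    (EfastN n P r (valTable n P) sol).map (Nat.cast : ℕ → ZMod certP) = Espec n P r sol := by
  ext a b
  rw [Matrix.map_apply, natCast_EfastN_apply]
  rfl

/-- The proposed inverse on `ℕ` (trivial accessor). [folklore] -/
def NinvN (r : ℕ) (sol : Array ℕ × Array ℕ × Array (Array ℕ)) : Matrix (Fin r) (Fin r) ℕ :=
  Matrix.of fun a b => (sol.2.2.getD a #[]).getD b 0

/-- **The trusted check** (run by `native_decide` in the instances files): the value table is
computed once, the untrusted solver proposes members / points / inverse, and `E · N = 1 (mod certP)`
is checked by `mulCheckN`. [folklore] -/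
def pencilCheck (n P r : ℕ) [NeZero P] : Bool :=
  let tbl := valTable n P
  let sol := solveCert tbl (4 * ((n + 1) * (n + 1))) P r
  mulCheckN r (EfastN n P r tbl sol) (NinvN r sol)

/-- **Soundness of the evaluation certificate.**  If `pencilCheck n P r = true` then the pencil family
`X_t · (∂_{kl} per_{n+1})(M·X)` of the integer pencil `M = pencilZ n` spans at least `r` dimensions:
`E · N = 1 ⇒ det E ≠ 0 (mod certP) ⇒ det ≠ 0 over ℂ` for the integer matrix of values of the `r`
selected members at the `r` selected points (`valP_eq_cast`, `prc_det_intCast_ne_zero_of_det_zmod_ne_zero`),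
whose entries are the evaluation functionals applied to the members (`aeval_member_eq_cast`), so the
selected members are linearly independent (`prc_linearIndependent_of_det_ne_zero`) and
`r ≤ finrank (span (range family))` (`prc_card_le_finrank_span_of_linearIndependent_comp`).
[folklore; this crux's …PencilRankCertificates.lean] -/
theorem le_finrank_of_pencilCheck (n P r : ℕ) [NeZero P] (h : pencilCheck n P r = true) :
    r ≤ Module.finrank ℂ ↥(Submodule.span ℂ (Set.range fun tc : Fin 4 × (Fin (n + 1) × Fin (n + 1)) =>
      (X tc.1 : MvPolynomial (Fin 4) ℂ) *
        aeval (fun ij : Fin (n + 1) × Fin (n + 1) =>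
          ∑ t : Fin 4, (fun ij t => ((pencilZ n ij t : ℤ) : ℂ)) ij t • (X t : MvPolynomial (Fin 4) ℂ))
          (pderiv tc.2 (perPoly (Fin (n + 1)) ℂ)))) := by
  classical
  set sol := solveCert (valTable n P) (4 * ((n + 1) * (n + 1))) P r with hsol
  -- the check: `E · N = 1` over `ZMod certP`
  have hEN : Espec n P r sol * (NinvN r sol).map (Nat.cast : ℕ → ZMod certP) = 1 := by
    rw [← map_EfastN]
    exact mulCheckN_sound r _ _ h
  have hdetP : (Espec n P r sol).det ≠ 0 := by
    intro h0
    have h2 := congrArg Matrix.det hEN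
    rw [Matrix.det_mul, h0, zero_mul, Matrix.det_one] at h2
    exact zero_ne_one h2
  -- the integer matrix of values
  set EZ : Matrix (Fin r) (Fin r) ℤ :=
    Matrix.of fun a b => memberValZ n (fun t => pointZ (selPoint P sol a) t) (selMember n sol b) with hEZ
  have hEZP : EZ.map (Int.castRingHom (ZMod certP)) = Espec n P r sol := by
    ext a b
    simp only [EZ, Espec, Matrix.map_apply, Matrix.of_apply, valP_eq_cast]
  have hdetC : (EZ.map (Int.castRingHom ℂ)).det ≠ 0 :=
    prc_det_intCast_ne_zero_of_det_zmod_ne_zero certP EZ (by rw [hEZP]; exact hdetP) ℂ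
  -- the family and the evaluation functionals
  set F : Fin 4 × (Fin (n + 1) × Fin (n + 1)) → MvPolynomial (Fin 4) ℂ := fun tc =>
    (X tc.1 : MvPolynomial (Fin 4) ℂ) *
      aeval (fun ij : Fin (n + 1) × Fin (n + 1) =>
        ∑ t : Fin 4, (fun ij t => ((pencilZ n ij t : ℤ) : ℂ)) ij t • (X t : MvPolynomial (Fin 4) ℂ))
        (pderiv tc.2 (perPoly (Fin (n + 1)) ℂ)) with hF
  let φ : Fin r → MvPolynomial (Fin 4) ℂ →ₗ[ℂ] ℂ := fun a =>
    (MvPolynomial.aeval fun s : Fin 4 => ((pointZ (selPoint P sol a) s : ℤ) : ℂ)).toLinearMap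
  have hmat : (Matrix.of fun a b : Fin r => φ a (F (selMember n sol b))) =
      EZ.map (Int.castRingHom ℂ) := by
    ext a b
    simp only [Matrix.of_apply, Matrix.map_apply, EZ, φ, F, AlgHom.toLinearMap_apply, eq_intCast]
    exact aeval_member_eq_cast n _ _
  have hli : LinearIndependent ℂ (F ∘ selMember n sol ∘ (fun b : Fin r => (b : ℕ))) := by
    refine prc_linearIndependent_of_det_ne_zero _ φ ?_
    simp only [Function.comp]
    rw [hmat]
    exact hdetC
  have hle := prc_card_le_finrank_span_of_linearIndependent_comp F
    (selMember n sol ∘ fun b : Fin r => (b : ℕ)) hli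
  simpa only [Fintype.card_fin] using hle

/-- The four cells `(0, 0..3)` of `pencilZ n` carry the unit vectors: the `4 × 4` coordinate matrix of
`frt_finrank_fourRowSpan_ge` (with `c t' = (0, t')`) is the identity, hence a unit. [folklore] -/
theorem pencilZ_cells_isUnit (n : ℕ) (h : 4 ≤ n + 1) :
    IsUnit (Matrix.of fun t t' : Fin 4 =>
      (fun ij t => ((pencilZ n ij t : ℤ) : ℂ)) ((fun t' : Fin 4 => ((0 : Fin (n + 1)), Fin.castLE h t')) t') t) := by
  have hM : (Matrix.of fun t t' : Fin 4 =>
      (fun ij t => ((pencilZ n ij t : ℤ) : ℂ)) ((fun t' : Fin 4 => ((0 : Fin (n + 1)), Fin.castLE h t')) t') t) =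
      (1 : Matrix (Fin 4) (Fin 4) ℂ) := by
    ext t t'
    simp only [Matrix.of_apply, pencilZ_def, Fin.val_zero, Fin.val_castLE, Matrix.one_apply]
    by_cases htt : t = t'
    · subst htt
      simp
    · rw [if_neg (fun h' => htt (Fin.ext h').symm), if_neg htt]
      simp
  rw [hM]
  exact isUnit_one

end Summit.ValiantsHypothesis.ValiantsHypothesis.Theorems.ValuativeFlip
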